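import Mathlib
import Literature.MathematicalPhysics.QuantumLattice.WilsonDiracAP

/-!
# The tadpole: finite averaging and the symmetries of the hopping form (auxiliary lemmas)
(helper for crux stmt-QuantumFields-9734, line `Sketch`, stub `stub_tadpole`)

What.  The algebra behind `stub_tadpole` (sibling file `…StubTadpole`): on the `2⁴` block
`(ℤ/2)⁴` (colour `Fin 3`, spin `Fin 4`) the functional `ℓ(E) = Re tr (B⁰⁻¹ Δ(E))` of the
matrix-valued link field `E : Edge 4 2 → M₃(ℂ)` only sees the colour traces `S_μ = Σ_x tr E(x,μ)`.
* Finite averaging (`adInvariant_apply`): an additive functional `g` on `M₃(ℂ)` invariant under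
  `A ↦ DAD` (`D = diag(±1)` real) and `A ↦ A.submatrix σ σ` satisfies `g A = g ((tr A / 3)·1)`:
  `A + D₀AD₀ + D₁AD₁ + D₁D₀AD₀D₁ = 4 diag A` kills the off-diagonal part (`sign_average`), and the
  three cyclic rotations of `diag A` sum to `(tr A)·1` (`cyclic_average`).
* Assembly (`assembly`): an additive, ℝ-homogeneous functional `f` of link fields invariant under
  block translations, diagonal colour signs and colour permutations satisfies
  `f E = Σ_μ f(tst_μ) · Re S_μ` when all `S_μ` are real (`E = Σ δ_{(x,μ)} E(x,μ)`, translate every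
  link to `(0, μ)`, re-sum, average, `Im S_μ = 0`), `tst_μ = (1/3)·1` on the link `(0, μ)`.
* Transport of `tr (B⁻¹ D)`: `tr ((B.submatrix e e)⁻¹ (D.submatrix e e)) = tr (B⁻¹ D)` and
  `tr ((PBP)⁻¹ (PDP)) = tr (B⁻¹ D)` for `P² = 1` (`Matrix.inv_submatrix_equiv`,
  `Matrix.mul_inv_rev`; `Matrix.inv` is the junk-valued nonsingular inverse, no invertibility of
  `B` is needed).
* The hopping form `H(C⁺, C⁻)` (colour blocks `C⁺_μ(x)` on `x → x + μ̂`, `C⁻_μ(y)` on `y + μ̂ → y`,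
  spin factors `1 ∓ γ_μ`, prefactor `−½`; abstracted as a function `H` with its defining equation,
  no `def`s): additive and homogeneous in the blocks, re-indexed by block translations and colour
  permutations into the hopping form of the translated/permuted blocks, and conjugated by diagonal
  colour matrices into the hopping form of the conjugated blocks (`hop_add`, `hop_smul`,
  `hop_submatrix_translate`, `hop_submatrix_perm`, `hop_diag_conj`).  In the sibling file
  `Δ(E) = H(uE, (uE)ᴴ)` and `B⁰ = (m + 4)·1 + H(u, ū)`.

References: Montvay–Münster, *Quantum Fields on a Lattice* §4.2 (Wilson fermions, hopping
expansion); folklore linear algebra. Pure theorem file (no `def`s).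
-/

noncomputable section

open scoped BigOperators Classical Matrix ComplexConjugate
open Finset
open Literature.MathematicalPhysics.QuantumLattice Literature.MathematicalPhysics.QuantumFieldTheory
  Literature.Probability.LatticeModels

namespace Summit.QuantumFields.QCD.Cruxes.CriticalLineDiamagnetism.ChessboardCellGain

namespace Tadpole

open Complex (I)

/-! ### Finite averaging: Ad-invariant additive functionals on `M₃(ℂ)` -/

/-- Sign averaging: with `D₀ = diag(-1,1,1)`, `D₁ = diag(1,-1,1)`,
`A + D₀AD₀ + D₁AD₁ + D₁(D₀AD₀)D₁ = 4 · diag(A)`. -/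
theorem sign_average (A : Matrix (Fin 3) (Fin 3) ℂ) :
    A + Matrix.diagonal (fun a => ((![-1, 1, 1] a : ℝ) : ℂ)) * A *
          Matrix.diagonal (fun a => ((![-1, 1, 1] a : ℝ) : ℂ)) +
        Matrix.diagonal (fun a => ((![1, -1, 1] a : ℝ) : ℂ)) * A *
          Matrix.diagonal (fun a => ((![1, -1, 1] a : ℝ) : ℂ)) +
        Matrix.diagonal (fun a => ((![1, -1, 1] a : ℝ) : ℂ)) *
          (Matrix.diagonal (fun a => ((![-1, 1, 1] a : ℝ) : ℂ)) * A *
            Matrix.diagonal (fun a => ((![-1, 1, 1] a : ℝ) : ℂ))) *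
          Matrix.diagonal (fun a => ((![1, -1, 1] a : ℝ) : ℂ)) =
      Matrix.diagonal A.diag + Matrix.diagonal A.diag + Matrix.diagonal A.diag +
        Matrix.diagonal A.diag := by
  ext a b
  fin_cases a <;> fin_cases b <;> simp

/-- Cyclic averaging: the three cyclic colour rotations of `diag(A)` sum to `(tr A)·1`, written as
three copies of `(tr A / 3)·1`. -/
theorem cyclic_average (A : Matrix (Fin 3) (Fin 3) ℂ) :
    Matrix.diagonal A.diag + (Matrix.diagonal A.diag).submatrix (finRotate 3) (finRotate 3) +
        (Matrix.diagonal A.diag).submatrix ((finRotate 3).trans (finRotate 3))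
          ((finRotate 3).trans (finRotate 3)) =
      (A.trace / 3) • (1 : Matrix (Fin 3) (Fin 3) ℂ) +
        (A.trace / 3) • (1 : Matrix (Fin 3) (Fin 3) ℂ) +
        (A.trace / 3) • (1 : Matrix (Fin 3) (Fin 3) ℂ) := by
  ext a b
  fin_cases a <;> fin_cases b <;>
    simp [Matrix.trace, Fin.sum_univ_three] <;> ring

/-- **Finite averaging.**  An additive functional on `M₃(ℂ)` invariant under conjugation by the real
diagonal sign matrices and under simultaneous row/column permutations only sees `tr A`:
`g A = g ((tr A / 3)·1)`. -/
theorem adInvariant_apply (g : Matrix (Fin 3) (Fin 3) ℂ → ℝ) (hadd : ∀ A B, g (A + B) = g A + g B)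
    (hdiag : ∀ d : Fin 3 → ℝ, (∀ a, d a * d a = 1) → ∀ A,
      g (Matrix.diagonal (fun a => (d a : ℂ)) * A * Matrix.diagonal (fun a => (d a : ℂ))) = g A)
    (hperm : ∀ (σ : Equiv.Perm (Fin 3)) A, g (A.submatrix σ σ) = g A)
    (A : Matrix (Fin 3) (Fin 3) ℂ) :
    g A = g ((A.trace / 3) • (1 : Matrix (Fin 3) (Fin 3) ℂ)) := by
  have h0 : ∀ a, (![-1, 1, 1] a : ℝ) * ![-1, 1, 1] a = 1 := by intro a; fin_cases a <;> simp
  have h1 : ∀ a, (![1, -1, 1] a : ℝ) * ![1, -1, 1] a = 1 := by intro a; fin_cases a <;> simp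
  -- step 1: the off-diagonal part is invisible
  have hA : g A = g (Matrix.diagonal A.diag) := by
    have h4 : (4 : ℝ) * g A = 4 * g (Matrix.diagonal A.diag) := by
      have key := congrArg g (sign_average A)
      rw [hadd, hadd, hadd, hdiag _ h1, hdiag _ h1, hdiag _ h0, hadd, hadd, hadd] at key
      linarith
    exact mul_left_cancel₀ four_ne_zero h4
  -- step 2: the diagonal part is seen only through its trace
  have hD : (3 : ℝ) * g (Matrix.diagonal A.diag) =
      3 * g ((A.trace / 3) • (1 : Matrix (Fin 3) (Fin 3) ℂ)) := by
    have key := congrArg g (cyclic_average A)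
    rw [hadd, hadd, hperm, hperm, hadd, hadd] at key
    linarith
  rw [hA]
  exact mul_left_cancel₀ three_ne_zero hD

/-- **Assembly.**  An additive, ℝ-homogeneous functional `f` on link fields `E : Edge 4 2 → M₃(ℂ)`
that is invariant under block translations, diagonal colour signs and colour permutations satisfies
`f E = Σ_μ f(tst_μ) · Re S_μ` whenever all `S_μ = Σ_x tr E(x,μ)` are real. -/
theorem assembly (f : (Edge 4 2 → Matrix (Fin 3) (Fin 3) ℂ) → ℝ)
    (hadd : ∀ E₁ E₂, f (E₁ + E₂) = f E₁ + f E₂)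
    (hsmul : ∀ (r : ℝ) (E : Edge 4 2 → Matrix (Fin 3) (Fin 3) ℂ), f ((r : ℂ) • E) = r * f E)
    (htrans : ∀ (t : TorusSite 4 2) (E : Edge 4 2 → Matrix (Fin 3) (Fin 3) ℂ),
      f (fun e => E (e.1 + t, e.2)) = f E)
    (hdiag : ∀ d : Fin 3 → ℝ, (∀ a, d a * d a = 1) → ∀ E : Edge 4 2 → Matrix (Fin 3) (Fin 3) ℂ,
      f (fun e => Matrix.diagonal (fun a => (d a : ℂ)) * E e *
        Matrix.diagonal (fun a => (d a : ℂ))) = f E)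
    (hperm : ∀ (σ : Equiv.Perm (Fin 3)) (E : Edge 4 2 → Matrix (Fin 3) (Fin 3) ℂ),
      f (fun e => (E e).submatrix σ σ) = f E)
    (E : Edge 4 2 → Matrix (Fin 3) (Fin 3) ℂ) (hE : ∀ μ, (∑ x, (E (x, μ)).trace).im = 0) :
    f E = ∑ μ, f (fun e => if e = ((0 : TorusSite 4 2), μ) then
        (1 / 3 : ℂ) • (1 : Matrix (Fin 3) (Fin 3) ℂ) else 0) * (∑ x, (E (x, μ)).trace).re := by
  -- the single-link functionals `A ↦ f(δ_{(0,μ)} A)` are additive and Ad-invariant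
  have hsadd : ∀ (μ : Fin 4) (A B : Matrix (Fin 3) (Fin 3) ℂ),
      f (Pi.single ((0 : TorusSite 4 2), μ) (A + B)) =
        f (Pi.single ((0 : TorusSite 4 2), μ) A) + f (Pi.single ((0 : TorusSite 4 2), μ) B) := by
    intro μ A B
    rw [Pi.single_add, hadd]
  have hsingle : ∀ (μ : Fin 4) (A : Matrix (Fin 3) (Fin 3) ℂ),
      f (Pi.single ((0 : TorusSite 4 2), μ) A) =
        f (Pi.single ((0 : TorusSite 4 2), μ)
          ((A.trace / 3) • (1 : Matrix (Fin 3) (Fin 3) ℂ))) := by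
    intro μ
    refine adInvariant_apply (fun A => f (Pi.single ((0 : TorusSite 4 2), μ) A)) (hsadd μ) ?_ ?_
    · intro d hd A
      rw [← hdiag d hd (Pi.single _ A)]
      congr 1
      funext e
      by_cases he : e = (0, μ)
      · subst he; simp
      · simp [he]
    · intro σ A
      rw [← hperm σ (Pi.single _ A)]
      congr 1
      funext e
      by_cases he : e = (0, μ)
      · subst he; simp
      · simp [he]
  -- `f` and the single-link functionals as additive monoid homomorphisms
  set F : (Edge 4 2 → Matrix (Fin 3) (Fin 3) ℂ) →+ ℝ := AddMonoidHom.mk' f hadd with hF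
  calc f E = F (∑ e, Pi.single e (E e)) := by rw [Finset.univ_sum_single]; rfl
    _ = ∑ μ, ∑ x, f (Pi.single (x, μ) (E (x, μ))) := by
      rw [map_sum, Fintype.sum_prod_type, Finset.sum_comm]; rfl
    _ = ∑ μ, ∑ x, f (Pi.single ((0 : TorusSite 4 2), μ) (E (x, μ))) := by
      refine Finset.sum_congr rfl fun μ _ => Finset.sum_congr rfl fun x _ => ?_
      rw [← htrans x (Pi.single (x, μ) (E (x, μ)))]
      congr 1
      funext e
      simp only [Pi.single_apply, Prod.ext_iff, add_eq_right]
    _ = ∑ μ, f (Pi.single ((0 : TorusSite 4 2), μ) (∑ x, E (x, μ))) := by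
      refine Finset.sum_congr rfl fun μ _ => ?_
      exact (map_sum (AddMonoidHom.mk' (fun A => f (Pi.single ((0 : TorusSite 4 2), μ) A))
        (hsadd μ)) (fun x => E (x, μ)) Finset.univ).symm
    _ = ∑ μ, f (fun e => if e = ((0 : TorusSite 4 2), μ) then
          (1 / 3 : ℂ) • (1 : Matrix (Fin 3) (Fin 3) ℂ) else 0) * (∑ x, (E (x, μ)).trace).re := by
      refine Finset.sum_congr rfl fun μ _ => ?_
      rw [hsingle, Matrix.trace_sum]
      set S : ℂ := ∑ x, (E (x, μ)).trace with hS
      have hSre : S = ((S.re : ℝ) : ℂ) := by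
        apply Complex.ext
        · simp
        · simpa [hS] using hE μ
      have h13 : (S / 3) • (1 : Matrix (Fin 3) (Fin 3) ℂ) =
          ((S.re : ℝ) : ℂ) • ((1 / 3 : ℂ) • (1 : Matrix (Fin 3) (Fin 3) ℂ)) := by
        rw [smul_smul, hSre, Complex.ofReal_re]; ring_nf
      rw [h13, Pi.single_smul, hsmul, mul_comm]
      congr 2
      funext e
      rw [Pi.single_apply]


/-! ### Transport of `tr (B⁻¹ D)` under re-indexing and involutive conjugation -/

/-- `tr ((B.submatrix e e)⁻¹ (D.submatrix e e)) = tr (B⁻¹ D)` for an equivalence `e` (the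
nonsingular inverse commutes with re-indexing, `Matrix.inv_submatrix_equiv`). -/
theorem trace_inv_mul_submatrix {ι : Type*} [Fintype ι] [DecidableEq ι] (B D : Matrix ι ι ℂ)
    (e : ι ≃ ι) : ((B.submatrix e e)⁻¹ * D.submatrix e e).trace = (B⁻¹ * D).trace := by
  rw [Matrix.inv_submatrix_equiv, Matrix.submatrix_mul_equiv]
  simp only [Matrix.trace, Matrix.diag_apply, Matrix.submatrix_apply]
  exact e.sum_comp (fun i => (B⁻¹ * D) i i)

/-- `tr ((PBP)⁻¹ (PDP)) = tr (B⁻¹ D)` for an involution `P² = 1` (`Matrix.mul_inv_rev` holds for the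
nonsingular inverse without any invertibility hypothesis on `B`). -/
theorem trace_inv_mul_conj {ι : Type*} [Fintype ι] [DecidableEq ι] (P B D : Matrix ι ι ℂ)
    (hP : P * P = 1) : ((P * B * P)⁻¹ * (P * D * P)).trace = (B⁻¹ * D).trace := by
  have hPinv : P⁻¹ = P := Matrix.inv_eq_left_inv hP
  rw [Matrix.mul_inv_rev, Matrix.mul_inv_rev, hPinv]
  calc (P * (B⁻¹ * P) * (P * D * P)).trace = (P * (B⁻¹ * D) * P).trace := by
        congr 1
        simp only [Matrix.mul_assoc]
        rw [← Matrix.mul_assoc P P, hP, Matrix.one_mul]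
    _ = (B⁻¹ * D).trace := by rw [Matrix.trace_mul_cycle, hP, Matrix.one_mul]

/-! ### The hopping form and its symmetries

The hopping form `H(C⁺, C⁻)` with colour blocks `C⁺_μ(x)` on the forward hop `x → x + μ̂` and
`C⁻_μ(y)` on the backward hop `y + μ̂ → y` (spin factors `1 ∓ γ_μ`, prefactor `−½`); it is
abstracted as a function `H` satisfying the defining equation `hH` (no `def`s in this file).  The
perturbation is `Δ(E) = H(uE, (uE)ᴴ)` and the free operator is `B⁰ = (m+4)·1 + H(u, ū)`. -/

section Hop

variable {H : (Fin 4 → TorusSite 4 2 → Matrix (Fin 3) (Fin 3) ℂ) →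
    (Fin 4 → TorusSite 4 2 → Matrix (Fin 3) (Fin 3) ℂ) →
      Matrix (TorusSite 4 2 × Fin 3 × Fin 4) (TorusSite 4 2 × Fin 3 × Fin 4) ℂ}

/-- `(x + t) + μ̂ = (x + μ̂) + t` on the torus. -/
theorem shift_add (x t : TorusSite 4 2) (μ : Fin 4) :
    Literature.MathematicalPhysics.QuantumFieldTheory.Site.shift (x + t) μ =
      Literature.MathematicalPhysics.QuantumFieldTheory.Site.shift x μ + t := by
  simp only [Literature.MathematicalPhysics.QuantumFieldTheory.Site.shift, add_right_comm]

variable (hH : ∀ Cp Cm, H Cp Cm = Matrix.of fun p q : TorusSite 4 2 × Fin 3 × Fin 4 =>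
    -(1 / 2 : ℂ) * ∑ μ : Fin 4,
      ((if q.1 = Literature.MathematicalPhysics.QuantumFieldTheory.Site.shift p.1 μ then
          ((1 : Matrix (Fin 4) (Fin 4) ℂ) - euclideanGamma μ) p.2.2 q.2.2 * Cp μ p.1 p.2.1 q.2.1
        else 0) +
        (if p.1 = Literature.MathematicalPhysics.QuantumFieldTheory.Site.shift q.1 μ then
          ((1 : Matrix (Fin 4) (Fin 4) ℂ) + euclideanGamma μ) p.2.2 q.2.2 * Cm μ q.1 p.2.1 q.2.1
        else 0)))
include hH

/-- The hopping form is additive in its blocks. -/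
theorem hop_add (Cp Cm Cp' Cm' : Fin 4 → TorusSite 4 2 → Matrix (Fin 3) (Fin 3) ℂ) :
    H (Cp + Cp') (Cm + Cm') = H Cp Cm + H Cp' Cm' := by
  ext p q
  simp only [hH, Matrix.add_apply, Matrix.of_apply, Pi.add_apply]
  rw [← mul_add, ← Finset.sum_add_distrib]
  congr 1
  refine Finset.sum_congr rfl fun μ _ => ?_
  split_ifs <;> ring

/-- The hopping form is homogeneous in its blocks. -/
theorem hop_smul (Cp Cm : Fin 4 → TorusSite 4 2 → Matrix (Fin 3) (Fin 3) ℂ) (c : ℂ) :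
    H (c • Cp) (c • Cm) = c • H Cp Cm := by
  ext p q
  simp only [hH, Matrix.smul_apply, Matrix.of_apply, Pi.smul_apply, smul_eq_mul, Finset.mul_sum]
  refine Finset.sum_congr rfl fun μ _ => ?_
  split_ifs <;> ring

/-- **Block translations** re-index the hopping form into the hopping form of the translated
blocks. -/
theorem hop_submatrix_translate (Cp Cm : Fin 4 → TorusSite 4 2 → Matrix (Fin 3) (Fin 3) ℂ)
    (t : TorusSite 4 2) :
    (H Cp Cm).submatrix (⇑((Equiv.addRight t).prodCongr (Equiv.refl (Fin 3 × Fin 4))))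
        (⇑((Equiv.addRight t).prodCongr (Equiv.refl (Fin 3 × Fin 4)))) =
      H (fun μ x => Cp μ (x + t)) (fun μ y => Cm μ (y + t)) := by
  ext p q
  simp only [hH, Matrix.submatrix_apply, Matrix.of_apply, Equiv.prodCongr_apply, Prod.map_fst,
    Prod.map_snd, Equiv.coe_addRight, Equiv.coe_refl, id_eq, shift_add, add_left_inj]

/-- **Colour permutations** re-index the hopping form into the hopping form of the permuted
blocks. -/
theorem hop_submatrix_perm (Cp Cm : Fin 4 → TorusSite 4 2 → Matrix (Fin 3) (Fin 3) ℂ)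
    (σ : Equiv.Perm (Fin 3)) :
    (H Cp Cm).submatrix
        (⇑((Equiv.refl (TorusSite 4 2)).prodCongr (σ.prodCongr (Equiv.refl (Fin 4)))))
        (⇑((Equiv.refl (TorusSite 4 2)).prodCongr (σ.prodCongr (Equiv.refl (Fin 4))))) =
      H (fun μ x => (Cp μ x).submatrix σ σ) (fun μ y => (Cm μ y).submatrix σ σ) := by
  ext p q
  simp only [hH, Matrix.submatrix_apply, Matrix.of_apply, Equiv.prodCongr_apply, Prod.map_fst,
    Prod.map_snd, Equiv.coe_refl, id_eq]

/-- **Diagonal colour matrices** conjugate the hopping form into the hopping form of the conjugated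
blocks. -/
theorem hop_diag_conj (Cp Cm : Fin 4 → TorusSite 4 2 → Matrix (Fin 3) (Fin 3) ℂ) (d : Fin 3 → ℂ) :
    Matrix.diagonal (fun p : TorusSite 4 2 × Fin 3 × Fin 4 => d p.2.1) * H Cp Cm *
        Matrix.diagonal (fun p : TorusSite 4 2 × Fin 3 × Fin 4 => d p.2.1) =
      H (fun μ x => Matrix.diagonal d * Cp μ x * Matrix.diagonal d)
        (fun μ y => Matrix.diagonal d * Cm μ y * Matrix.diagonal d) := by
  ext p q
  simp only [hH, Matrix.diagonal_mul, Matrix.mul_diagonal, Matrix.of_apply]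
  rw [show ∀ a b c S : ℂ, a * (c * S) * b = c * (a * S * b) from fun a b c S => by ring,
    Finset.mul_sum, Finset.sum_mul]
  congr 1
  refine Finset.sum_congr rfl fun μ _ => ?_
  split_ifs <;> ring

end Hop

end Tadpole

/-- **Registered sub-goal of this auxiliary file** (`stub_tadpoleAux`, the assembly lemma
`Tadpole.assembly`): an additive, ℝ-homogeneous functional of link fields on the `2⁴` block that
is invariant under block translations, real diagonal colour signs and colour permutations satisfies
`f E = Σ_μ f(tst_μ) · Re S_μ` whenever all colour traces `S_μ = Σ_x tr E(x,μ)` are real. -/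
theorem stub_tadpoleAux : ∀ (f : (Edge 4 2 → Matrix (Fin 3) (Fin 3) ℂ) → ℝ), (∀ E₁ E₂, f (E₁ + E₂) = f E₁ + f E₂) → (∀ (r : ℝ) (E : Edge 4 2 → Matrix (Fin 3) (Fin 3) ℂ), f ((r : ℂ) • E) = r * f E) → (∀ (t : TorusSite 4 2) (E : Edge 4 2 → Matrix (Fin 3) (Fin 3) ℂ), f (fun e => E (e.1 + t, e.2)) = f E) → (∀ d : Fin 3 → ℝ, (∀ a, d a * d a = 1) → ∀ E : Edge 4 2 → Matrix (Fin 3) (Fin 3) ℂ, f (fun e => Matrix.diagonal (fun a => (d a : ℂ)) * E e * Matrix.diagonal (fun a => (d a : ℂ))) = f E) → (∀ (σ : Equiv.Perm (Fin 3)) (E : Edge 4 2 → Matrix (Fin 3) (Fin 3) ℂ), f (fun e => (E e).submatrix σ σ) = f E) → ∀ E : Edge 4 2 → Matrix (Fin 3) (Fin 3) ℂ, (∀ μ : Fin 4, (∑ x : TorusSite 4 2, (E (x, μ)).trace).im = 0) → f E = ∑ μ : Fin 4, f (fun e => if e = ((0 : TorusSite 4 2), μ) then (1 / 3 : ℂ)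 • (1 : Matrix (Fin 3) (Fin 3) ℂ) else 0) * (∑ x : TorusSite 4 2, (E (x, μ)).trace).re :=
  Tadpole.assembly

end Summit.QuantumFields.QCD.Cruxes.CriticalLineDiamagnetism.ChessboardCellGain

end
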